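import Mathlib
import HarnessLib
import HarnessLib.Audit
import Summits.AtomisticToContinuum.Statement
import Literature.MathematicalPhysics.QuantumManyBody.PeriodicBoseGas

/-!
Route: BECThomsonDuality

CLOSED (retired) 2026-08-15T13:55:33Z by operator:999:2305528 — reason: not-a-thesis: assembly does not conclude the sub-problem Statement — note: D-0027 §2.1 audit (human 2026-08-15: routes that do not decide the summit are removed): the assembly concludes `Literature.MathematicalPhysics.QuantumManyBody.BoseGas.BoseEinsteinCondensation`, not the sub-problem statement; a NEW conforming route may be opened from the same idea (generated `closes . The file is kept as the record of this route; refuted decls are indexed as negative knowledge (`ledger negatives`).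

# Route BECThomsonDuality — Gaussian domination as a configuration-space resistance bound (one
Thomson flow over Ψ₀²) plus KLS with the LNSS excitation operator

X = GDCan ∧ (GDCan → PeriodicBEC) ∧ BoundaryTransferWeak ("it suffices to show X"). GDCan (CANONICAL
GAUSSIAN DOMINATION ON THE
TORUS, item GaussianDominationCan): for every repulsive finite-range v and window parameter M there
are ρ₀, C, N₀ with: for N ≥ N₀ bosons
on the torus of side L at density N/L³ ≤ ρ₀, every k = 2πn/L ≠ 0 with |k| ≤ M√(N/L³), every s ≥ 0
and every periodic trial state Φ,
periodicEnergy(Φ) − 2s|⟨Φ, Λ_k† Φ⟩| ≥ E₀^per(N,L) − C s² L²/‖n‖², where Λ_k† = a_k† a_0 n̂₀^(-1/2)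
is the Lewin–Nam–Serfaty–Solovej
excitation creation operator written in configuration space (P_i = average of particle i over the
cell, n̂₀ = Σ_i P_i,
n̂₀^(-1/2) = Σ_S |S|^(-1/2) Π_(i∈S) P_i Π_(i∉S) (1−P_i)) — the ground-state energy is stiff
(transverse susceptibility ≤ 2C/k²) against
the phase source, uniformly in N and L. The route realises card thomson-flow-gaussian-domination:
GDCan is to be proved by Thomson's
principle for the ground-state Dirichlet form (ONE admissible flow on (T³)^N bounds the
susceptibility; fibre flows = crux
FibreConductance, bath charge = density channel = crux DensityResponse), and is transferred to
PeriodicBEC (verbatim the crux of route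
BECPeriodicReduction) by the T = 0 Kennedy–Lieb–Shastry inequality (crux GDTransfer);
BoundaryTransferWeak (shared verbatim with
BECPeriodicReduction) gives the Dirichlet conjunct.
Lean: `open Literature.MathematicalPhysics.QuantumManyBody.BoseGas in (∀ v : ℝ → ENNReal,
IsRepulsiveFiniteRange v → ∀ M : ℝ, 0 < M → ∃ ρ₀ C : ℝ, 0 < ρ₀ ∧ 0 < C ∧ ∃ N₀ : ℕ, ∀ m : ℕ, N₀ ≤ m +
1 → ∀ L : ℝ, 0 < L → ((m + 1 : ℕ) : ℝ) ≤ ρ₀ * L ^ 3 → ∀ n : Fin 3 → ℤ, n ≠ 0 → 2 * Real.pi * ‖(fun j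
=> (n j : ℝ))‖ / L ≤ M * Real.sqrt ((m + 1 : ℕ) / L ^ 3) → ∀ s : ℝ, 0 ≤ s → ∀ Φ : PeriodicTrialState
(m + 1) L, let P : Fin (m + 1) → (Config (m + 1) → ℂ) → (Config (m + 1) → ℂ) := fun i g X => ((L ^
3)⁻¹ : ℝ) • ∫ y in cell L, g (Function.update X i y); let Q : Finset (Fin (m + 1)) → (Config (m + 1)
→ ℂ) → (Config (m + 1) → ℂ) := fun S g => (List.finRange (m + 1)).foldr (fun i h => if i ∈ S then P
i h else h - P i h) g; let Θ : Config (m + 1) → ℂ := fun X => ∑ S ∈ (Finset.univ : Finset (Finset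
(Fin (m + 1)))).filter (fun S => (0 : Fin (m + 1)) ∈ S), ((Real.sqrt (S.card : ℝ))⁻¹ : ℂ) * Q S Φ.ψ
X; periodicGroundStateEnergy v (m + 1) L + ENNReal.ofReal (s * (2 * (m + 1) * ‖∫ X in cellN (m + 1)
L, (starRingEnd ℂ) (Φ.ψ X) * Complex.exp (Complex.I * ↑(2 * Real.pi / L * ∑ j, (n j : ℝ) * X 0 j)) *
Θ X‖)) ≤ periodicEnergy v Φ + ENNReal.ofReal (C * s ^ 2 * L ^ 2 / ‖(fun j => (n j : ℝ))‖ ^ 2)) ∧ ((∀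
v : ℝ → ENNReal, IsRepulsiveFiniteRange v → ∀ M : ℝ, 0 < M → ∃ ρ₀ C : ℝ, 0 < ρ₀ ∧ 0 < C ∧ ∃ N₀ : ℕ,
∀ m : ℕ, N₀ ≤ m + 1 → ∀ L : ℝ, 0 < L → ((m + 1 : ℕ) : ℝ) ≤ ρ₀ * L ^ 3 → ∀ n : Fin 3 → ℤ, n ≠ 0 → 2 *
Real.pi * ‖(fun j => (n j : ℝ))‖ / L ≤ M * Real.sqrt ((m + 1 : ℕ) / L ^ 3) → ∀ s : ℝ, 0 ≤ s → ∀ Φ :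
PeriodicTrialState (m + 1) L, let P : Fin (m + 1) → (Config (m + 1) → ℂ) → (Config (m + 1) → ℂ) :=
fun i g X => ((L ^ 3)⁻¹ : ℝ) • ∫ y in cell L, g (Function.update X i y); let Q : Finset (Fin (m +
1)) → (Config (m + 1) → ℂ) → (Config (m + 1) → ℂ) := fun S g => (List.finRange (m + 1)).foldr (fun i
h => if i ∈ S then P i h else h - P i h) g; let Θ : Config (m + 1) → ℂ := fun X => ∑ S ∈
(Finset.univ : Finset (Finset (Fin (m + 1)))).filter (fun S => (0 : Fin (m + 1)) ∈ S), ((Real.sqrt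
(S.card : ℝ))⁻¹ : ℂ) * Q S Φ.ψ X; periodicGroundStateEnergy v (m + 1) L + ENNReal.ofReal (s * (2 *
(m + 1) * ‖∫ X in cellN (m + 1) L, (starRingEnd ℂ) (Φ.ψ X) * Complex.exp (Complex.I * ↑(2 * Real.pi
/ L * ∑ j, (n j : ℝ) * X 0 j)) * Θ X‖)) ≤ periodicEnergy v Φ + ENNReal.ofReal (C * s ^ 2 * L ^ 2 /
‖(fun j => (n j : ℝ))‖ ^ 2)) → ∀ v : ℝ → ENNReal, IsRepulsiveFiniteRange v → ∃ ρ₀ : ℝ, 0 < ρ₀ ∧ ∀ ρ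
: ℝ, 0 < ρ → ρ < ρ₀ → ∃ c : ℝ, 0 < c ∧ ∀ᶠ N : ℕ in Filter.atTop, ∃ δ : ENNReal, 0 < δ ∧ ∀ Ψ :
PeriodicTrialState N (sideLength ρ N), periodicEnergy v Ψ ≤ periodicGroundStateEnergy v N
(sideLength ρ N) + δ → ENNReal.ofReal (c * N) ≤ condensateOccupation N (sideLength ρ N) Ψ.ψ) ∧ (∀ v
: ℝ → ENNReal, IsRepulsiveFiniteRange v → (∃ ρ₀ : ℝ, 0 < ρ₀ ∧ ∀ ρ : ℝ, 0 < ρ → ρ < ρ₀ → ∃ c : ℝ, 0 <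
c ∧ ∀ᶠ N : ℕ in Filter.atTop, ∃ δ : ENNReal, 0 < δ ∧ ∀ Ψ : PeriodicTrialState N (sideLength ρ N),
periodicEnergy v Ψ ≤ periodicGroundStateEnergy v N (sideLength ρ N) + δ → ENNReal.ofReal (c * N) ≤
condensateOccupation N (sideLength ρ N) Ψ.ψ) → ∃ ρ₀ : ℝ, 0 < ρ₀ ∧ ∀ ρ : ℝ, 0 < ρ → ρ < ρ₀ →
HasGroundStateBEC v ρ)`

## Assembly
Pure logic (term proof in Sketch.lean / SketchInline.lean: fun hG hT hB v hv => hB v hv ((hT hG) v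
hv)): GDTransfer consumes GDCan and
yields PeriodicBEC; BoundaryTransferWeak turns PeriodicBEC(v) into HasGroundStateBEC v ρ for small
ρ, which is the conjunct.
FibreConductance, DensityResponse and UpperBoundPeriodic are stepping stones for the proofs of
GaussianDominationCan and GDTransfer and
do not enter the term.

Rationale: WHY THIS LINE. For a positive ground state Ψ₀ the T = 0 static susceptibility of a source A is a
dual Dirichlet norm,
χ_A = 2‖(AΨ₀)Ψ₀‖²_(H⁻¹(Ψ₀²dX)) = 2 inf ∫|J|²/Ψ₀² over flows with div J = (AΨ₀)Ψ₀ (ground-state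
representation + Thomson's principle; for
one molecule this is Prager–Hirschfelder doi:10.1063/1.1734192), so the ONE inequality reflection
positivity ever supplied (Gaussian
domination: DysonLiebSimon1978, KennedyLiebShastry1988; barrier HalfFillingReflectionPositivity;
lattice chain in-tree:
kls_xy_gaussianDomination_ground → kennedy_lieb_shastry_xy_ground) becomes an upper bound on an
effective RESISTANCE, provable the way
probabilists prove transience — exhibit one finite-energy flow (LyonsPeres2016 Ch. 2,
GrimmettKestenZhang1993) — and configuration
space gives every particle three private directions, so fibre costs add with no cross terms.
Imported area: electrical-network /
Dirichlet-form duality (potential theory, probability) with the explicit dictionary conductivity ↦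
Ψ₀², charge ↦ (AΨ₀)Ψ₀, effective
resistance ↦ χ_A/2, "transience-type finiteness" ↦ GD; physically GDCan says the phase stiffness ρ_s
stays ≥ cρ at every scale up to L
(Leggett's T = 0 variational bounds doi:10.1023/b:joss.0000033170.38619.6c are the nearest
precedent, one-body and for the opposite
inequality). Beyond the card and its two audits: (i) the source is the LNSS excitation operator Λ_k
(arXiv:1211.2778; the
Girardeau–Arnowitt / Castin–Dum number-conserving Bogoliubov operator), for which Λ†Λ = n_k exactly,
ΛΛ† = (n_k+1)1_(n₀≥1) and
[T, Λ] = −k²Λ, so KLS bounds n_k ITSELF — the card's X_k = a_k†a_0/√N only bounds ⟨n̂₀ n̂_k⟩, is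
vacuous on uncondensed states, and its
clopen-in-L selection fails at the level of n₀-distributions; (ii) audit-14's hidden hypothesis is
filed as the explicit crux
DensityResponse (the bath charge left after fibre flows is −(1/2S(k))× a density wave, not −½×) and
the circular "current trick" is
dropped; (iii) GD is typed as a chord inequality for all s ≥ 0 (large s is free since ‖Λ_k‖ ≤ √N),
uniformly down the density scale
(∀ N ≥ N₀, ∀ L with N ≤ ρ₀L³). Negatives index: empty, nothing to steer around. (This route re-files
route-AtomisticToContinuum-BECThomsonFlows, retired not-a-thesis at 13:41Z solely for lack of the
D-0027 deciding theorem, now supplied as `closes : GaussianDominationCan → GDTransfer →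
BoundaryTransferWeak → BoseEinsteinCondensation`.)

RANKED CRUXES. #0 Target (target) — X = GDCan ∧ (GDCan → PeriodicBEC) ∧ BoundaryTransferWeak as in §
Thesis (all three inlined under a term-level `open … in`; PeriodicBEC and BoundaryTransferWeak are
rfl-equal to route BECPeriodicReduction's decls, checked in SketchDedup.lean). (why it might fail:
GDCan is the continuum T = 0 Gaussian-domination statement itself (no reflection positivity is
available); the transfer needs Dyson's O(ρaN) upper bound and a contact cutoff for hard cores.)
[LSSY2005, KennedyLiebShastry1988, DysonLiebSimon1978, arXiv:1211.2778]
#2 GaussianDominationCan (crux) — (card items F1+F2+GD_can, restated per audit-14) canonical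
Gaussian domination on the torus for the LNSS excitation source, chord form: ∀ v ∀ M ∃ ρ₀ C N₀ ∀ N ≥
N₀ ∀ L (N ≤ ρ₀L³) ∀ n ≠ 0 (2π‖n‖/L ≤ M√(N/L³)) ∀ s ≥ 0 ∀ Φ: E₀^per + s·2N|∫ conj(Φ) e^(ik·x₀) (P₀
n̂₀^(-1/2) Φ)| ≤ periodicEnergy Φ + C s² L²/‖n‖² (i.e. E₀(H + s(Λ_k^θ + Λ_k^θ†)) ≥ E₀ − C s²/k² for
every phase θ). To be proved by Thomson flows over Ψ₀²: fibre flows (FibreConductance) + bath charge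
= −(1/2S(k)) × density wave (DensityResponse + the Stringari/Puff floor S(k) ≥ k/c₃) + two-phonon
remainders. Free gas: equality with C = 1/4π² (displaced oscillator in the excitation picture);
Bogoliubov: b_Λ/2 = (u+v)²/e_k = 1/k². [difficulty: open-problem] (why it might fail: two-phonon
bath charges: crude fibre bounds give Σ_q S(q)/q⁴ ~ log(L/ξ), so L-uniformity needs their true
(stiff) H⁻¹ norms — a closure problem; hard cores need cross-fibre detours around cages; negative
v̂(k₀) kills the SHARP constant (audit-2), only C = O(1) is claimed.) [DysonLiebSimon1978,
KennedyLiebShastry1988, LSSY2005, doi:10.1063/1.1734192, arXiv:1211.2778, LyonsPeres2016]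
#3 FibreConductance (crux) — (card F1, typed for bounded v and exact C¹ minimisers Φ without zeros)
with W(X̂) = ∫|Φ(y,X̂)|²dy, ψ = |Φ|/√W (conditional amplitude of particle 0 given the bath X̂),
β(X̂) = ∫e^(ik·y)ψ(y,X̂)dy and the fibre-neutral charge q = L^(-3/2)(e^(ik·x₀)ψ − βψ²): there is a
flow J in the x₀-fibre, with weak divergence q on the torus (∫ J·∇₀η = −∫ qη for every C¹ periodic
η), such that ∫ |J|² W/ψ² ≤ C L²/‖n‖² — the bath-averaged one-body resistance of the frozen
landscape at wavelength 1/k is ≤ C/k². Free gas: J = k̂ e^(ik·x₀)ψ/(i|k|) L^(-3/2), cost exactly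
1/k². Dips of ψ are harmless (charge ∝ ψ, conductivity ∝ ψ²: the local cost is depth-independent);
only closed shells (cages) cost. [difficulty: L] (why it might fail: rare baths cage particle 0
behind shells where ψ ~ e^(−K u(0)); fibre-only flows then pay e^(+2K u(0)) and the claim needs
(probability of K-shells) × (cost) summable uniformly in N (Jastrow cluster suppression says yes,
unproved); false verbatim for hard cores, which are excluded here.) [doi:10.1063/1.1734192,
LyonsPeres2016, GrimmettKestenZhang1993, ReattoChester1967, LSSY2005]
#4 DensityResponse (crux) — (audit-14's hidden hypothesis made explicit; the same statement as card
kv-insertion-corrector's K1 StaticResponseBound) density-channel chord bound at compressibility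
level: ∀ v ∀ M ∃ ρ₀ C N₀ ∀ N ≥ N₀ ∀ L (N ≤ ρ₀L³) ∀ n ≠ 0 in the window ∀ s ≥ 0 ∀ Φ: E₀^per + s|∫
(Σ_i 2cos(k·x_i))|Φ|²| ≤ periodicEnergy Φ + C s² N/(k² + (N/L³)·a), a = scattering length of v
(toReal; 0 for v = 0, where the free value χ/N = 2/k² shows the form is sharp); i.e. χ_ρρ(k) ≤
2CN/(k² + ρa) — Feynman single-mode saturation up to constants (Bogoliubov: 2N/(k² + 16πρa)),
uniformly down to k = 2π/L. [difficulty: open-problem] (why it might fail: a chord bound down to s →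
0 is a true curvature bound: LHY-precision asymptotics control E₀(s) only for s ≳ ρa(ρa³)^(1/4) and
concavity does not propagate below, so anomalously soft low-k density weight (no Landau-type floor
is known in the thermodynamic limit) is excluded by no printed method.) [FournaisSolovej2020,
Feynman1954, PitaevskiiStringari1991, Stringari1995, LSSY2005]
#5 GDTransfer (crux) — GDCan → PeriodicBEC (PeriodicBEC verbatim = BECPeriodicReduction.PeriodicBEC;
GDCan inlined as the antecedent). Mechanism: T = 0 Kennedy–Lieb–Shastry run variationally with Φ_t =
Ψ + tζ, ζ = (Λ_k^θ + Λ_k^θ†)Ψ, for a δ-near-minimiser Ψ: GDCan at (s,t) with s = t‖ζ‖²k²/C gives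
‖ζ‖⁴ ≤ C c_k/k², c_k = second variation of the energy form at ζ ≤ 2(k² + C'ρ), while ‖ζ‖² ≥ ⟨Ψ, n̂_k
Ψ⟩ (Λ†Λ = n̂_k); hence n_k ≤ √(2C)(1 + √(C'ρ)/k) in the window, Σ_window n_k = O(√C M³ √ρ N),
kinetic Chebyshev above the window Σ_(|k|>M√ρ) n_k ≤ (E₀+δ)/(M²ρ) ≤ 4πaN(1+o(1))/M² (Dyson's bound,
support UpperBoundPeriodic), Parseval on the cell ⇒ ⟨Ψ, n̂₀Ψ⟩ ≥ (1 − 4πa/M² − O(M³√(ρa³)))N; choose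
M then ρ₀. [deps: GaussianDominationCan] [difficulty: L] (why it might fail: for hard cores the bare
ζ has infinite energy (c_k = ∞): needs a contact cutoff F with ⟨ζ,(1−F)ζ⟩ = O(ρa³)‖ζ‖² and finite
c_F; near-minimisers are not eigenstates (first-variation errors O(√δ), momentum not sharp); 3-D
Parseval on the cell and Dyson's upper bound are not in Mathlib.) [KennedyLiebShastry1988,
KLS1988JSP, PitaevskiiStringari1991, arXiv:1211.2778, LSSY2005, Fournais2020]
#6 BoundaryTransferWeak (crux) — (shared verbatim with route BECPeriodicReduction, its rank-3 crux;
rfl-checked) for each repulsive finite-range v, PeriodicBEC(v) ⇒ ∃ρ₀ > 0 ∀ρ ∈ (0,ρ₀)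
HasGroundStateBEC v ρ (Dirichlet box, mode-free criterion via condensateNumber). [deps: GDTransfer]
[difficulty: L] (why it might fail: Dirichlet and periodic ground-state energies differ by a wall
term far above the near-minimiser slack, so no energy-comparison proof exists; needs Neumann
bracketing of interior boxes plus a mode-free criterion; BEC can be boundary-condition sensitive
(Robinson 1976).) [LSSY2005, BoccatoSeiringer2023, Junge2026, doi:10.1007/bf01608554]
#9 UpperBoundPeriodic (support) — the O(ρaN) upper bound E₀^per(N,L) ≤ 4πρ₁a(1 + C a/b)N (LSSY2005
Thm 2.2, Dyson's trial state) — the named fact LSSY2005_upperBound_periodic, wanted as an in-tree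
theorem (for integrable v the constant trial state already gives E₀^per ≤ ½Nρ∫v); consumed by
GDTransfer's kinetic-Chebyshev step; not in the assembly chain. [difficulty: M] [LSSY2005,
Dyson1957]

TWO-LAYER PLAN. Foreseen glued splits (nothing filed now): GaussianDominationCan ⇐ FibreStep →
BathStep → GaussianDominationCan, where FibreStep =
FibreConductance extended to the Λ-charge (coefficients P_i n̂₀^(-1/2)Ψ₀ instead of P_iΨ₀) and
BathStep = "the fibre-averaged bath
charge has H⁻¹(Ψ₀²) norm ≤ C/k² given DensityResponse" (regression on ρ_k with coefficient
−(1−S)/(2SN) plus a two-phonon remainder),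
once the ground-state Dirichlet-form vocabulary lands (definition request); GDTransfer ⇐
KLSVariational → ModeCounting → GDTransfer
(KLS for bounded sources over PeriodicTrialState; Parseval + kinetic Chebyshev + Dyson);
DensityResponse ⇐ high-k (Neumann
localisation to Fournais boxes, facts Fournais2020 / Junge2026) → low-k (LDA against
FournaisSolovej2020) for s above the precision
threshold only — the s → 0 part stays the crux.

KILL CRITERIA. ¬GaussianDominationCan for some admissible v at arbitrarily small density (a
transverse susceptibility ≫ 1/k² at k ~ 2π/L, i.e. phase
stiffness → 0 at large scales) closes the route (close --reason refuted:GaussianDominationCan) and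
physically T = 0 superfluidity;
¬DensityResponse (soft density weight at low k) forces a pivot to a Landau-conditional bridge (card
sector-gap-no-cheap-momentum) but
does not kill GDCan; ¬FibreConductance for bounded v kills the flow MECHANISM (route becomes
hypothesis-only: supersede by a
continuum-gaussian-domination route if one is open); PeriodicBEC proved elsewhere moots cruxes 2–5;
¬BoundaryTransferWeak kills this
route and BECPeriodicReduction alike (not the conjunct).

NOT DECOMPOSED YET. The H⁻¹(Ψ₀²)/Thomson identity itself (needs the exact ground state as an object:
definition request), the floor S(k) ≥ k/c₃
(Stringari/Puff moment inequality; known, support-level, m₃ finite only for smooth v), the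
two-phonon remainder bound, the contact
cutoff for hard cores, Parseval on the 3-D cell, the dependence of constants on v (needed to reach
hard cores by monotone truncation
v_n ↑ v) — all layer-2 children or prover lemmas (`--supports`).

CHEAPEST FALSIFIER. (a) Jastrow-level numerics (kit, hours): with Ψ₀ = McMillan–Reatto Jastrow at
ρa³ = 10⁻³ regress the conditional Fourier coefficient
Ψ̂₀^(i)(k;X̂) on ρ_k(X̂): the coefficient must be −(1−S(k))/(2S(k)N) within 20% and the regression
residual's fibre-free H⁻¹ proxy must be
o(1/k²)-compatible — a coefficient of modulus ≥ 1/(S(k)N) or a residual ∝ 1/k³ retires the flow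
mechanism; (b) paper check done here,
consistent: in Bogoliubov theory b_Λ/2 = (u+v)²/e_k = 1/k² exactly and χ_ρρ/N = 2/(k² + 16πρa), so
GaussianDominationCan (C ≥ 1) and
DensityResponse (C ≥ 2) hold at that level; (c) closed-form 1-D Tonks check (Ψ₀ = Π|sin|):
FibreConductance must FAIL there (cages)
while the window count diverges — if instead FibreConductance held in 1-D the mechanism would prove
too much.

NUMBERS. Bogoliubov values (units ħ = 2m = 1): e_k = √(k⁴ + 16πρa k²), c = 4√(πρa), ξ =
(8πρa)^(-1/2), S(k) = k²/e_k, (u−v)² = k²/e_k,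
(u+v)² = e_k/k²; transverse susceptibility b/2 = 1/k² (phase quadrature) and k²/e_k² ≤ 1/k² (density
quadrature); χ_ρρ(k)/N =
2/(k² + 16πρa); n_k → c/(4k) for kξ ≪ 1; KLS output n_k ≤ √(2C)(1 + √(C'ρ)/k); window #modes
(4π/3)(M√ρ L/2π)³ = M³√ρ N/(6π²)
(M carries units length^(1/2), M = M'√a gives O(M'³√(ρa³))N); kinetic tail ≤ 4πaN(1+o(1))/M²;
Josephson: exact b/2 → (n₀/ρ_s-type)(1/k²)
at k → 0 with ρ_s = ρ at T = 0. Items at open: 8.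

DEFINITION REQUESTS. - GroundStateDirichletForm / weighted H⁻¹ norm on Config N over the density of
an exact minimiser (topic
  Literature/MathematicalPhysics/QuantumManyBody): E_w(F) = ∫|∇F|²w, ‖q‖²_(H⁻¹(w)) = sup_F (2Re∫
conj(F) q − E_w(F)) = inf ∫|J|²/w over
  div J = q (Thomson), and the identity χ_A = 2‖(AΨ₀)Ψ₀‖²_(H⁻¹(Ψ₀²)) for bounded A — wanted for the
layer-2 split of GaussianDominationCan.
- ExcitationMap (Lewin–Nam–Serfaty–Solovej U_N; configuration-space form of a_k, a_k† on the N-body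
torus:
  Λ_k† = Σ_i e^(ik·x_i) P_i ∘ n̂₀^(-1/2)) — would replace GaussianDominationCan's inline lets by one
Literature constant.
- Cite facts wanted as hypotheses: none beyond LSSY2005_upperBound_periodic (exists in
PeriodicBoseGas.lean).

Novelty: Searches (2026-08-15): lit frontier AtomisticToContinuum --since 2020 (30 rows; BEC descendants
arXiv:2603.20776, arXiv:2510.20493,
arXiv:2602.16566 — none on GD/flows); lit bridges AtomisticToContinuum --cross any (0 relevant); lit
search --source crossref ×4
("Gaussian domination interacting Bose gas continuum…": doi:10.1142/s0217979299002988,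
doi:10.1007/978-3-0348-8018-3_5,
doi:10.1016/j.physleta.2013.08.045; "variational upper bound polarizability Thomson Prager
Hirschfelder": doi:10.1063/1.1734192,
doi:10.1063/1.1695770, doi:10.1016/0009-2614(71)80238-5; "Leggett superfluid fraction T=0 bounds":
doi:10.1023/b:joss.0000033170.38619.6c
(paywalled, acq-01700); "number-conserving Bogoliubov Castin Dum Girardeau":
doi:10.1103/physreva.58.775, doi:10.1063/1.4881536);
lit search --hybrid local (8 docs, textbooks only); lit galaxy search "Gaussian domination" --star
all (18 rows, all RP/lattice:
Friedli–Velenik, LSSY2005 Ch. 11, Tasaki, Peled–Spinka); openalex/arxiv HTTP 429 this hour, zbmath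
0; plus the card's two audits
(crossref ×4, hybrid ×3, galaxy ×9, 4 reads).
Nearest prior art found: doi:10.1063/1.1734192 Prager–Hirschfelder 1963 (second-order energy =
electrostatic energy of the charge
ψ₀(V−E₁)ψ₀ in the dielectric ψ₀²; trial fields give upper bounds — one molecule, no N- or
L-uniformity); doi:10.1023/b:joss.0000033170.38619.6c
Leggett 1998 (variational upper/lower bounds on ρ_s at T = 0 from the one-body density);
DysonLiebSimon1978 / KennedyLiebShastry1988
(GD ⇒ IR ⇒  [refs: 10.1142/s0217979299002988, 10.1007/978-3-0348-8018-3_5, 10.1016/j.physleta.2013.08.045, 10.1063/1.1734192, 10.1063/1.1695770, 10.1016/0009-2614(71, 10.1023/b:joss.0000033170.38619.6c, 10.1103/physreva.58.775, 10.1063/1.4881536, 2603.20776, 2510.20493, 2602.16566, 1211.2778, doi:10.1142/s0217979299002988, doi:10.1007/978-3-0348-8018-3_5, doi:10.1016/j.physleta.2013.08.045, doi:10.1063/1.1734192, do]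

Barriers (technique_class: Gaussian-domination, thomson-duality, infrared-bound): - technique_class: Gaussian-domination, thomson-duality, infrared-bound
- Literature.Barriers.AtomisticToContinuum.HalfFillingReflectionPositivity: attacked head-on — GD is
sought from the dual (Thomson) variational principle of the ground-state Dirichlet form, which needs
Ψ₀ > 0 (any repulsive v) but no reflection, lattice or half filling; honest: GaussianDominationCan
is open; the bet is that flows tolerate O(1) sloppiness where RP gives identities.
- Literature.Barriers.AtomisticToContinuum.KineticGapLengthScales: evaded — no (box side)² × (excess
energy) bookkeeping anywhere; L-uniformity is asked of a resistance bound and of DensityResponse;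
the gap method may enter only DensityResponse's high-k layer-2 child on Fournais boxes ℓ ≪ L, where
it is legitimate.
- Literature.Barriers.AtomisticToContinuum.EnergyAsymptoticsWithoutCondensation: respected — energy
asymptotics of H alone are never used to infer BEC; DensityResponse is a response bound for a
perturbed family (the entry's listed evasion) and its why-might-fail records exactly where LHY
precision stops (s → 0).
- Literature.Barriers.AtomisticToContinuum.BogoliubovPerturbationInfrared: evaded — no expansion
around the Bogoliubov state; the d = 3 logarithms can resurface only as the two-phonon closure
problem flagged in GaussianDominationCan's why-might-fail, not as a divergent series.
- Literature.Barriers.AtomisticToContinuum.PitaevskiiStringariOneDimension: consistent — KLS and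
sum-rule inequalities are dimension-fr

History (route lifecycle, newest last):
- 2026-08-15T13:55:33Z · CLOSED retired — not-a-thesis: assembly does not conclude the sub-problem Statement (operator:999:2305528)

sub-problem: BoseEinsteinCondensation · status: closed(retired) · opened planner-plancard-AtomisticToContinuum-BoseEin-e92e37bd-0 2026-08-15T13:48:24Z · rev 0 · ledger route-AtomisticToContinuum-BECThomsonDuality
GENERATED by the gate from the ledger (D-0016/17). Provers cite these decls: `theorem foo : Summit.AtomisticToContinuum.BoseEinsteinCondensation.Theses.BECThomsonDuality.<Decl> := …` in Summits/AtomisticToContinuum/BoseEinsteinCondensation/Theorems/<Name>.lean.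
-/

namespace Summit.AtomisticToContinuum.BoseEinsteinCondensation.Theses.BECThomsonDuality

open scoped BigOperators Topology Manifold Classical MeasureTheory ProbabilityTheory Matrix InnerProductSpace ComplexConjugate ContinuousMap
open Filter Set Function TopologicalSpace MeasureTheory

attribute [summit_statement] _root_.BoseEinsteinCondensation

/-- item stmt-AtomisticToContinuum-9100 · target · rank 0 · closed · moot by None · by planner
why it might fail: GDCan is the continuum T = 0 Gaussian-domination statement itself (no reflection positivity is available); the transfer needs Dyson's O(ρaN) upper bound and a contact cutoff for hard cores.
sources: LSSY2005, KennedyLiebShastry1988, DysonLiebSimon1978, arXiv:1211.2778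
[target] X = GDCan ∧ (GDCan → PeriodicBEC) ∧ BoundaryTransferWeak as in § Thesis (all three inlined
under a term-level `open … in`; PeriodicBEC and BoundaryTransferWeak are rfl-equal to route
BECPeriodicReduction's decls, checked in SketchDedup.lean). -/
@[route_item "route-AtomisticToContinuum-BECThomsonDuality"]
def Target : Prop :=
  open Literature.MathematicalPhysics.QuantumManyBody.BoseGas in (∀ v : ℝ → ENNReal, IsRepulsiveFiniteRange v → ∀ M : ℝ, 0 < M → ∃ ρ₀ C : ℝ, 0 < ρ₀ ∧ 0 < C ∧ ∃ N₀ : ℕ, ∀ m : ℕ, N₀ ≤ m + 1 → ∀ L : ℝ, 0 < L → ((m + 1 : ℕ) : ℝ) ≤ ρ₀ * L ^ 3 → ∀ n : Fin 3 → ℤ, n ≠ 0 → 2 * Real.pi * ‖(fun j => (n j : ℝ))‖ / L ≤ M * Real.sqrt ((m + 1 : ℕ) / L ^ 3) → ∀ s : ℝ, 0 ≤ s → ∀ Φ : PeriodicTrialState (m + 1) L, let P : Fin (m + 1) → (Config (m + 1) → ℂ) → (Config (m + 1) → ℂ) := fun i g X => ((L ^ 3)⁻¹ : ℝ) • ∫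 y in cell L, g (Function.update X i y); let Q : Finset (Fin (m + 1)) → (Config (m + 1) → ℂ) → (Config (m + 1) → ℂ) := fun S g => (List.finRange (m + 1)).foldr (fun i h => if i ∈ S then P i h else h - P i h) g; let Θ : Config (m + 1) → ℂ := fun X => ∑ S ∈ (Finset.univ : Finset (Finset (Fin (m + 1)))).filter (fun S => (0 : Fin (m + 1)) ∈ S), ((Real.sqrt (S.card : ℝ))⁻¹ : ℂ) * Q S Φ.ψ X; periodicGroundStateEnergy v (m + 1) L + ENNReal.ofReal (s * (2 * (m + 1) * ‖∫ X in cellN (m + 1) L, (starRingEnd ℂ) (Φ.ψ X) * Complex.exp (Complex.I * ↑(2 * Real.pi / L * ∑ j, (n j : ℝ) * X 0 j)) * Θ X‖)) ≤ periodicEnergy v Φ + ENNReal.ofReal (C * s ^ 2 * L ^ 2 / ‖(fun j => (n j : ℝ))‖ ^ 2)) ∧ ((∀ v : ℝ → ENNReal, IsRepulsiveFiniteRange v → ∀ M : ℝ, 0 < M → ∃ ρ₀ C : ℝ, 0 < ρ₀ ∧ 0 < C ∧ ∃ N₀ : ℕ, ∀ m : ℕ, N₀ ≤ m + 1 → ∀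 L : ℝ, 0 < L → ((m + 1 : ℕ) : ℝ) ≤ ρ₀ * L ^ 3 → ∀ n : Fin 3 → ℤ, n ≠ 0 → 2 * Real.pi * ‖(fun j => (n j : ℝ))‖ / L ≤ M * Real.sqrt ((m + 1 : ℕ) / L ^ 3) → ∀ s : ℝ, 0 ≤ s → ∀ Φ : PeriodicTrialState (m + 1) L, let P : Fin (m + 1) → (Config (m + 1) → ℂ) → (Config (m + 1) → ℂ) := fun i g X => ((L ^ 3)⁻¹ : ℝ) • ∫ y in cell L, g (Function.update X i y); let Q : Finset (Fin (m + 1)) → (Config (m + 1) → ℂ) → (Config (m + 1) → ℂ) := fun S g => (List.finRange (m + 1)).foldr (fun i h => if i ∈ S then P i h else h - P i h) g; let Θ : Config (m + 1) → ℂ := fun X => ∑ S ∈ (Finset.univ : Finset (Finset (Fin (m + 1)))).filter (fun S => (0 : Fin (m + 1)) ∈ S), ((Real.sqrt (S.card : ℝ))⁻¹ : ℂ) * Q S Φ.ψ X; periodicGroundStateEnergy v (m + 1) L + ENNReal.ofReal (s * (2 * (m + 1) * ‖∫ X in cellN (m + 1) L, (starRingEnd ℂ) (Φ.ψ X) * Complex.exp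 (Complex.I * ↑(2 * Real.pi / L * ∑ j, (n j : ℝ) * X 0 j)) * Θ X‖)) ≤ periodicEnergy v Φ + ENNReal.ofReal (C * s ^ 2 * L ^ 2 / ‖(fun j => (n j : ℝ))‖ ^ 2)) → ∀ v : ℝ → ENNReal, IsRepulsiveFiniteRange v → ∃ ρ₀ : ℝ, 0 < ρ₀ ∧ ∀ ρ : ℝ, 0 < ρ → ρ < ρ₀ → ∃ c : ℝ, 0 < c ∧ ∀ᶠ N : ℕ in Filter.atTop, ∃ δ : ENNReal, 0 < δ ∧ ∀ Ψ : PeriodicTrialState N (sideLength ρ N), periodicEnergy v Ψ ≤ periodicGroundStateEnergy v N (sideLength ρ N) + δ → ENNReal.ofReal (c * N) ≤ condensateOccupation N (sideLength ρ N) Ψ.ψ) ∧ (∀ v : ℝ → ENNReal, IsRepulsiveFiniteRange v → (∃ ρ₀ : ℝ, 0 < ρ₀ ∧ ∀ ρ : ℝ, 0 < ρ → ρ < ρ₀ → ∃ c : ℝ, 0 < c ∧ ∀ᶠ N : ℕ in Filter.atTop, ∃ δ : ENNReal, 0 < δ ∧ ∀ Ψ : PeriodicTrialState N (sideLength ρ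 N), periodicEnergy v Ψ ≤ periodicGroundStateEnergy v N (sideLength ρ N) + δ → ENNReal.ofReal (c * N) ≤ condensateOccupation N (sideLength ρ N) Ψ.ψ) → ∃ ρ₀ : ℝ, 0 < ρ₀ ∧ ∀ ρ : ℝ, 0 < ρ → ρ < ρ₀ → HasGroundStateBEC v ρ)

/-- item stmt-AtomisticToContinuum-9101 · crux · rank 2 · closed · moot by None · by planner
why it might fail: two-phonon bath charges: crude fibre bounds give Σ_q S(q)/q⁴ ~ log(L/ξ), so L-uniformity needs their true (stiff) H⁻¹ norms — a closure problem; hard cores need cross-fibre detours around cages; negative v̂(k₀) kills the SHARP constant (audit-2), only C = O(1) is claimed.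
sources: DysonLiebSimon1978, KennedyLiebShastry1988, LSSY2005, doi:10.1063/1.1734192, arXiv:1211.2778, LyonsPeres2016
[crux] (card items F1+F2+GD_can, restated per audit-14) canonical Gaussian domination on the torus
for the LNSS excitation source, chord form: ∀ v ∀ M ∃ ρ₀ C N₀ ∀ N ≥ N₀ ∀ L (N ≤ ρ₀L³) ∀ n ≠ 0
(2π‖n‖/L ≤ M√(N/L³)) ∀ s ≥ 0 ∀ Φ: E₀^per + s·2N|∫ conj(Φ) e^(ik·x₀) (P₀ n̂₀^(-1/2) Φ)| ≤
periodicEnergy Φ + C s² L²/‖n‖² (i.e. E₀(H + s(Λ_k^θ + Λ_k^θ†)) ≥ E₀ − C s²/k² for every phase θ).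
To be proved by Thomson flows over Ψ₀²: fibre flows (FibreConductance) + bath charge = −(1/2S(k)) ×
density wave (DensityResponse + the Stringari/Puff floor S(k) ≥ k/c₃) + two-phonon remainders. Free
gas: equality with C = 1/4π² (displaced oscillator in the excitation picture); Bogoliubov: b_Λ/2 =
(u+v)²/e_k = 1/k². [difficulty: open-problem] -/
@[route_item "route-AtomisticToContinuum-BECThomsonDuality"]
def GaussianDominationCan : Prop :=
  ∀ v : ℝ → ENNReal, Literature.MathematicalPhysics.QuantumManyBody.BoseGas.IsRepulsiveFiniteRange v → ∀ M : ℝ, 0 < M → ∃ ρ₀ C : ℝ, 0 < ρ₀ ∧ 0 < C ∧ ∃ N₀ : ℕ, ∀ m : ℕ, N₀ ≤ m + 1 → ∀ L : ℝ, 0 < L → ((m + 1 : ℕ) : ℝ) ≤ ρ₀ * L ^ 3 → ∀ n : Fin 3 → ℤ, n ≠ 0 → 2 * Real.pi * ‖(fun j => (n j : ℝ))‖ / L ≤ M * Real.sqrt ((m + 1 : ℕ) / L ^ 3) → ∀ s : ℝ, 0 ≤ s → ∀ Φ : Literature.MathematicalPhysics.QuantumManyBody.BoseGas.PeriodicTrialState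 (m + 1) L, let P : Fin (m + 1) → (Literature.MathematicalPhysics.QuantumManyBody.BoseGas.Config (m + 1) → ℂ) → (Literature.MathematicalPhysics.QuantumManyBody.BoseGas.Config (m + 1) → ℂ) := fun i g X => ((L ^ 3)⁻¹ : ℝ) • ∫ y in Literature.MathematicalPhysics.QuantumManyBody.BoseGas.cell L, g (Function.update X i y); let Q : Finset (Fin (m + 1)) → (Literature.MathematicalPhysics.QuantumManyBody.BoseGas.Config (m + 1) → ℂ) → (Literature.MathematicalPhysics.QuantumManyBody.BoseGas.Config (m + 1) → ℂ) := fun S g => (List.finRange (m + 1)).foldr (fun i h => if i ∈ S then P i h else h - P i h) g; let Θ : Literature.MathematicalPhysics.QuantumManyBody.BoseGas.Config (m + 1) → ℂ := fun X => ∑ S ∈ (Finset.univ : Finset (Finset (Fin (m + 1)))).filter (fun S => (0 : Fin (m + 1)) ∈ S), ((Real.sqrt (S.card : ℝ))⁻¹ : ℂ) * Q S Φ.ψ X; Literature.MathematicalPhysics.QuantumManyBody.BoseGas.periodicGroundStateEnergy v (m + 1) L + ENNReal.ofReal (s * (2 * (m + 1) * ‖∫ X in Literature.MathematicalPhysics.QuantumManyBody.BoseGas.cellN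 (m + 1) L, (starRingEnd ℂ) (Φ.ψ X) * Complex.exp (Complex.I * ↑(2 * Real.pi / L * ∑ j, (n j : ℝ) * X 0 j)) * Θ X‖)) ≤ Literature.MathematicalPhysics.QuantumManyBody.BoseGas.periodicEnergy v Φ + ENNReal.ofReal (C * s ^ 2 * L ^ 2 / ‖(fun j => (n j : ℝ))‖ ^ 2)

/-- item stmt-AtomisticToContinuum-9102 · crux · rank 3 · closed · moot by None · by planner
why it might fail: rare baths cage particle 0 behind shells where ψ ~ e^(−K u(0)); fibre-only flows then pay e^(+2K u(0)) and the claim needs (probability of K-shells) × (cost) summable uniformly in N (Jastrow cluster suppression says yes, unproved); false verbatim for hard cores, which are excluded here.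
sources: doi:10.1063/1.1734192, LyonsPeres2016, GrimmettKestenZhang1993, ReattoChester1967, LSSY2005
[crux] (card F1, typed for bounded v and exact C¹ minimisers Φ without zeros) with W(X̂) =
∫|Φ(y,X̂)|²dy, ψ = |Φ|/√W (conditional amplitude of particle 0 given the bath X̂), β(X̂) =
∫e^(ik·y)ψ(y,X̂)dy and the fibre-neutral charge q = L^(-3/2)(e^(ik·x₀)ψ − βψ²): there is a flow J in
the x₀-fibre, with weak divergence q on the torus (∫ J·∇₀η = −∫ qη for every C¹ periodic η), such
that ∫ |J|² W/ψ² ≤ C L²/‖n‖² — the bath-averaged one-body resistance of the frozen landscape at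
wavelength 1/k is ≤ C/k². Free gas: J = k̂ e^(ik·x₀)ψ/(i|k|) L^(-3/2), cost exactly 1/k². Dips of ψ
are harmless (charge ∝ ψ, conductivity ∝ ψ²: the local cost is depth-independent); only closed
shells (cages) cost. [difficulty: L] -/
@[route_item "route-AtomisticToContinuum-BECThomsonDuality"]
def FibreConductance : Prop :=
  ∀ v : ℝ → ENNReal, Literature.MathematicalPhysics.QuantumManyBody.BoseGas.IsRepulsiveFiniteRange v → (∃ B : ℝ, ∀ r, v r ≤ ENNReal.ofReal B) → ∀ M : ℝ, 0 < M → ∃ ρ₀ C : ℝ, 0 < ρ₀ ∧ 0 < C ∧ ∃ N₀ : ℕ, ∀ m : ℕ, N₀ ≤ m + 1 → ∀ L : ℝ, 0 < L → ((m + 1 : ℕ) : ℝ) ≤ ρ₀ * L ^ 3 → ∀ n : Fin 3 → ℤ, n ≠ 0 → 2 * Real.pi * ‖(fun j => (n j : ℝ))‖ / L ≤ M * Real.sqrt ((m + 1 : ℕ) / L ^ 3) → ∀ Φ : Literature.MathematicalPhysics.QuantumManyBody.BoseGas.PeriodicTrialState (m + 1) L, Literature.MathematicalPhysics.QuantumManyBody.BoseGas.periodicEnergy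 v Φ = Literature.MathematicalPhysics.QuantumManyBody.BoseGas.periodicGroundStateEnergy v (m + 1) L → (∀ X, Φ.ψ X ≠ 0) → let W : Literature.MathematicalPhysics.QuantumManyBody.BoseGas.Config (m + 1) → ℝ := fun X => ∫ y in Literature.MathematicalPhysics.QuantumManyBody.BoseGas.cell L, ‖Φ.ψ (Function.update X 0 y)‖ ^ 2; let ψ : Literature.MathematicalPhysics.QuantumManyBody.BoseGas.Config (m + 1) → ℝ := fun X => ‖Φ.ψ X‖ / Real.sqrt (W X); let β : Literature.MathematicalPhysics.QuantumManyBody.BoseGas.Config (m + 1) → ℂ := fun X => ∫ y in Literature.MathematicalPhysics.QuantumManyBody.BoseGas.cell L, Complex.exp (Complex.I * ↑(2 * Real.pi / L * ∑ j, (n j : ℝ) * y j)) * (ψ (Function.update X 0 y) : ℂ); let q : Literature.MathematicalPhysics.QuantumManyBody.BoseGas.Config (m + 1) → ℂ := fun X => ((Real.sqrt (L ^ 3))⁻¹ : ℂ) * (Complex.exp (Complex.I * ↑(2 * Real.pi / L * ∑ j, (n j : ℝ) * X 0 j)) * (ψ X : ℂ) - β X * (ψ X : ℂ) ^ 2); ∃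 J : Literature.MathematicalPhysics.QuantumManyBody.BoseGas.Config (m + 1) → (Fin 3 → ℂ), (∀ η : Literature.MathematicalPhysics.QuantumManyBody.BoseGas.Config (m + 1) → ℂ, ContDiff ℝ 1 η → (∀ X (i : Fin (m + 1)) (l : Fin 3), η (X + Pi.single i (EuclideanSpace.single l L)) = η X) → ∫ X in Literature.MathematicalPhysics.QuantumManyBody.BoseGas.cellN (m + 1) L, ∑ l : Fin 3, J X l * fderiv ℝ η X (Pi.single 0 (EuclideanSpace.single l (1 : ℝ))) = - ∫ X in Literature.MathematicalPhysics.QuantumManyBody.BoseGas.cellN (m + 1) L, q X * η X) ∧ ∫⁻ X in Literature.MathematicalPhysics.QuantumManyBody.BoseGas.cellN (m + 1) L, ENNReal.ofReal ((∑ l : Fin 3, ‖J X l‖ ^ 2) * W X / ψ X ^ 2) ≤ ENNReal.ofReal (C * L ^ 2 / ‖(fun j => (n j : ℝ))‖ ^ 2)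

/-- item stmt-AtomisticToContinuum-9103 · crux · rank 4 · closed · moot by None · by planner
why it might fail: a chord bound down to s → 0 is a true curvature bound: LHY-precision asymptotics control E₀(s) only for s ≳ ρa(ρa³)^(1/4) and concavity does not propagate below, so anomalously soft low-k density weight (no Landau-type floor is known in the thermodynamic limit) is excluded by no printed method.
sources: FournaisSolovej2020, Feynman1954, PitaevskiiStringari1991, Stringari1995, LSSY2005
[crux] (audit-14's hidden hypothesis made explicit; the same statement as card
kv-insertion-corrector's K1 StaticResponseBound) density-channel chord bound at compressibility
level: ∀ v ∀ M ∃ ρ₀ C N₀ ∀ N ≥ N₀ ∀ L (N ≤ ρ₀L³) ∀ n ≠ 0 in the window ∀ s ≥ 0 ∀ Φ: E₀^per + s|∫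
(Σ_i 2cos(k·x_i))|Φ|²| ≤ periodicEnergy Φ + C s² N/(k² + (N/L³)·a), a = scattering length of v
(toReal; 0 for v = 0, where the free value χ/N = 2/k² shows the form is sharp); i.e. χ_ρρ(k) ≤
2CN/(k² + ρa) — Feynman single-mode saturation up to constants (Bogoliubov: 2N/(k² + 16πρa)),
uniformly down to k = 2π/L. [difficulty: open-problem] -/
@[route_item "route-AtomisticToContinuum-BECThomsonDuality"]
def DensityResponse : Prop :=
  ∀ v : ℝ → ENNReal, Literature.MathematicalPhysics.QuantumManyBody.BoseGas.IsRepulsiveFiniteRange v → ∀ M : ℝ, 0 < M → ∃ ρ₀ C : ℝ, 0 < ρ₀ ∧ 0 < C ∧ ∃ N₀ : ℕ, ∀ N : ℕ, N₀ ≤ N → ∀ L : ℝ, 0 < L → (N : ℝ) ≤ ρ₀ * L ^ 3 → ∀ n : Fin 3 → ℤ, n ≠ 0 → 2 * Real.pi * ‖(fun j => (n j : ℝ))‖ / L ≤ M * Real.sqrt (N / L ^ 3) → ∀ s : ℝ, 0 ≤ s → ∀ Φ : Literature.MathematicalPhysics.QuantumManyBody.BoseGas.PeriodicTrialState N L, Literature.MathematicalPhysics.QuantumManyBody.BoseGas.periodicGroundStateEnergy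 v N L + ENNReal.ofReal (s * |∫ X in Literature.MathematicalPhysics.QuantumManyBody.BoseGas.cellN N L, (∑ i, 2 * Real.cos (2 * Real.pi / L * ∑ j, (n j : ℝ) * X i j)) * ‖Φ.ψ X‖ ^ 2|) ≤ Literature.MathematicalPhysics.QuantumManyBody.BoseGas.periodicEnergy v Φ + ENNReal.ofReal (C * s ^ 2 * N / ((2 * Real.pi * ‖(fun j => (n j : ℝ))‖ / L) ^ 2 + N / L ^ 3 * (Literature.MathematicalPhysics.QuantumManyBody.BoseGas.scatteringLength v).toReal))

/-- item stmt-AtomisticToContinuum-9104 · crux · rank 5 · closed · moot by None · by planner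
why it might fail: for hard cores the bare ζ has infinite energy (c_k = ∞): needs a contact cutoff F with ⟨ζ,(1−F)ζ⟩ = O(ρa³)‖ζ‖² and finite c_F; near-minimisers are not eigenstates (first-variation errors O(√δ), momentum not sharp); 3-D Parseval on the cell and Dyson's upper bound are not in Mathlib.
sources: KennedyLiebShastry1988, KLS1988JSP, PitaevskiiStringari1991, arXiv:1211.2778, LSSY2005, Fournais2020
[crux] GDCan → PeriodicBEC (PeriodicBEC verbatim = BECPeriodicReduction.PeriodicBEC; GDCan inlined
as the antecedent). Mechanism: T = 0 Kennedy–Lieb–Shastry run variationally with Φ_t = Ψ + tζ, ζ =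
(Λ_k^θ + Λ_k^θ†)Ψ, for a δ-near-minimiser Ψ: GDCan at (s,t) with s = t‖ζ‖²k²/C gives ‖ζ‖⁴ ≤ C
c_k/k², c_k = second variation of the energy form at ζ ≤ 2(k² + C'ρ), while ‖ζ‖² ≥ ⟨Ψ, n̂_k Ψ⟩ (Λ†Λ
= n̂_k); hence n_k ≤ √(2C)(1 + √(C'ρ)/k) in the window, Σ_window n_k = O(√C M³ √ρ N), kinetic
Chebyshev above the window Σ_(|k|>M√ρ) n_k ≤ (E₀+δ)/(M²ρ) ≤ 4πaN(1+o(1))/M² (Dyson's bound, support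
UpperBoundPeriodic), Parseval on the cell ⇒ ⟨Ψ, n̂₀Ψ⟩ ≥ (1 − 4πa/M² − O(M³√(ρa³)))N; choose M then
ρ₀. [deps: GaussianDominationCan] [difficulty: L] -/
@[route_item "route-AtomisticToContinuum-BECThomsonDuality"]
def GDTransfer : Prop :=
  (∀ v : ℝ → ENNReal, Literature.MathematicalPhysics.QuantumManyBody.BoseGas.IsRepulsiveFiniteRange v → ∀ M : ℝ, 0 < M → ∃ ρ₀ C : ℝ, 0 < ρ₀ ∧ 0 < C ∧ ∃ N₀ : ℕ, ∀ m : ℕ, N₀ ≤ m + 1 → ∀ L : ℝ, 0 < L → ((m + 1 : ℕ) : ℝ) ≤ ρ₀ * L ^ 3 → ∀ n : Fin 3 → ℤ, n ≠ 0 → 2 * Real.pi * ‖(fun j => (n j : ℝ))‖ / L ≤ M * Real.sqrt ((m + 1 : ℕ) / L ^ 3) → ∀ s : ℝ, 0 ≤ s → ∀ Φ : Literature.MathematicalPhysics.QuantumManyBody.BoseGas.PeriodicTrialState (m + 1) L, let P : Fin (m + 1) → (Literature.MathematicalPhysics.QuantumManyBody.BoseGas.Config (m + 1) → ℂ) → (Literature.MathematicalPhysics.QuantumManyBody.BoseGas.Config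 (m + 1) → ℂ) := fun i g X => ((L ^ 3)⁻¹ : ℝ) • ∫ y in Literature.MathematicalPhysics.QuantumManyBody.BoseGas.cell L, g (Function.update X i y); let Q : Finset (Fin (m + 1)) → (Literature.MathematicalPhysics.QuantumManyBody.BoseGas.Config (m + 1) → ℂ) → (Literature.MathematicalPhysics.QuantumManyBody.BoseGas.Config (m + 1) → ℂ) := fun S g => (List.finRange (m + 1)).foldr (fun i h => if i ∈ S then P i h else h - P i h) g; let Θ : Literature.MathematicalPhysics.QuantumManyBody.BoseGas.Config (m + 1) → ℂ := fun X => ∑ S ∈ (Finset.univ : Finset (Finset (Fin (m + 1)))).filter (fun S => (0 : Fin (m + 1)) ∈ S), ((Real.sqrt (S.card : ℝ))⁻¹ : ℂ) * Q S Φ.ψ X; Literature.MathematicalPhysics.QuantumManyBody.BoseGas.periodicGroundStateEnergy v (m + 1) L + ENNReal.ofReal (s * (2 * (m + 1) * ‖∫ X in Literature.MathematicalPhysics.QuantumManyBody.BoseGas.cellN (m + 1) L, (starRingEnd ℂ) (Φ.ψ X) * Complex.exp (Complex.I * ↑(2 * Real.pi / L * ∑ j, (n j : ℝ) * X 0 j))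 * Θ X‖)) ≤ Literature.MathematicalPhysics.QuantumManyBody.BoseGas.periodicEnergy v Φ + ENNReal.ofReal (C * s ^ 2 * L ^ 2 / ‖(fun j => (n j : ℝ))‖ ^ 2)) → ∀ v : ℝ → ENNReal, Literature.MathematicalPhysics.QuantumManyBody.BoseGas.IsRepulsiveFiniteRange v → ∃ ρ₀ : ℝ, 0 < ρ₀ ∧ ∀ ρ : ℝ, 0 < ρ → ρ < ρ₀ → ∃ c : ℝ, 0 < c ∧ ∀ᶠ N : ℕ in Filter.atTop, ∃ δ : ENNReal, 0 < δ ∧ ∀ Ψ : Literature.MathematicalPhysics.QuantumManyBody.BoseGas.PeriodicTrialState N (Literature.MathematicalPhysics.QuantumManyBody.BoseGas.sideLength ρ N), Literature.MathematicalPhysics.QuantumManyBody.BoseGas.periodicEnergy v Ψ ≤ Literature.MathematicalPhysics.QuantumManyBody.BoseGas.periodicGroundStateEnergy v N (Literature.MathematicalPhysics.QuantumManyBody.BoseGas.sideLength ρ N) + δ → ENNReal.ofReal (c * N) ≤ Literature.MathematicalPhysics.QuantumManyBody.BoseGas.condensateOccupation N (Literature.MathematicalPhysics.QuantumManyBody.BoseGas.sideLength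 ρ N) Ψ.ψ

/-- item stmt-AtomisticToContinuum-9105 · support · rank 9 · closed · moot by None · by planner
sources: LSSY2005, Dyson1957
[support] the O(ρaN) upper bound E₀^per(N,L) ≤ 4πρ₁a(1 + C a/b)N (LSSY2005 Thm 2.2, Dyson's trial
state) — the named fact LSSY2005_upperBound_periodic, wanted as an in-tree theorem (for integrable v
the constant trial state already gives E₀^per ≤ ½Nρ∫v); consumed by GDTransfer's kinetic-Chebyshev
step; not in the assembly chain. [difficulty: M] -/
@[route_item "route-AtomisticToContinuum-BECThomsonDuality"]
def UpperBoundPeriodic : Prop :=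
  Literature.MathematicalPhysics.QuantumManyBody.BoseGas.LSSY2005_upperBound_periodic

/-- item stmt-AtomisticToContinuum-9106 · assembly · rank 1 · closed · moot by None · by planner
sources: LSSY2005, KennedyLiebShastry1988
[assembly] GaussianDominationCan → GDTransfer → BoundaryTransferWeak → BoseEinsteinCondensation (all
inlined under a term-level `open … in`; rfl-equal to the decl-name chain, checked in
SketchShort.lean). -/
@[route_item "route-AtomisticToContinuum-BECThomsonDuality"]
def Assembly : Prop :=
  open Literature.MathematicalPhysics.QuantumManyBody.BoseGas in (∀ v : ℝ → ENNReal, IsRepulsiveFiniteRange v → ∀ M : ℝ, 0 < M → ∃ ρ₀ C : ℝ, 0 < ρ₀ ∧ 0 < C ∧ ∃ N₀ : ℕ, ∀ m : ℕ, N₀ ≤ m + 1 → ∀ L : ℝ, 0 < L → ((m + 1 : ℕ) : ℝ) ≤ ρ₀ * L ^ 3 → ∀ n : Fin 3 → ℤ, n ≠ 0 → 2 * Real.pi * ‖(fun j => (n j : ℝ))‖ / L ≤ M * Real.sqrt ((m + 1 : ℕ) / L ^ 3) → ∀ s : ℝ, 0 ≤ s → ∀ Φ : PeriodicTrialState (m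 + 1) L, let P : Fin (m + 1) → (Config (m + 1) → ℂ) → (Config (m + 1) → ℂ) := fun i g X => ((L ^ 3)⁻¹ : ℝ) • ∫ y in cell L, g (Function.update X i y); let Q : Finset (Fin (m + 1)) → (Config (m + 1) → ℂ) → (Config (m + 1) → ℂ) := fun S g => (List.finRange (m + 1)).foldr (fun i h => if i ∈ S then P i h else h - P i h) g; let Θ : Config (m + 1) → ℂ := fun X => ∑ S ∈ (Finset.univ : Finset (Finset (Fin (m + 1)))).filter (fun S => (0 : Fin (m + 1)) ∈ S), ((Real.sqrt (S.card : ℝ))⁻¹ : ℂ) * Q S Φ.ψ X; periodicGroundStateEnergy v (m + 1) L + ENNReal.ofReal (s * (2 * (m + 1) * ‖∫ X in cellN (m + 1) L, (starRingEnd ℂ) (Φ.ψ X) * Complex.exp (Complex.I * ↑(2 * Real.pi / L * ∑ j, (n j : ℝ) * X 0 j)) * Θ X‖)) ≤ periodicEnergy v Φ + ENNReal.ofReal (C * s ^ 2 * L ^ 2 / ‖(fun j => (n j : ℝ))‖ ^ 2)) → ((∀ v : ℝ → ENNReal, IsRepulsiveFiniteRange v → ∀ M : ℝ, 0 < M → ∃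 ρ₀ C : ℝ, 0 < ρ₀ ∧ 0 < C ∧ ∃ N₀ : ℕ, ∀ m : ℕ, N₀ ≤ m + 1 → ∀ L : ℝ, 0 < L → ((m + 1 : ℕ) : ℝ) ≤ ρ₀ * L ^ 3 → ∀ n : Fin 3 → ℤ, n ≠ 0 → 2 * Real.pi * ‖(fun j => (n j : ℝ))‖ / L ≤ M * Real.sqrt ((m + 1 : ℕ) / L ^ 3) → ∀ s : ℝ, 0 ≤ s → ∀ Φ : PeriodicTrialState (m + 1) L, let P : Fin (m + 1) → (Config (m + 1) → ℂ) → (Config (m + 1) → ℂ) := fun i g X => ((L ^ 3)⁻¹ : ℝ) • ∫ y in cell L, g (Function.update X i y); let Q : Finset (Fin (m + 1)) → (Config (m + 1) → ℂ) → (Config (m + 1) → ℂ) := fun S g => (List.finRange (m + 1)).foldr (fun i h => if i ∈ S then P i h else h - P i h) g; let Θ : Config (m + 1) → ℂ := fun X => ∑ S ∈ (Finset.univ : Finset (Finset (Fin (m + 1)))).filter (fun S => (0 : Fin (m + 1)) ∈ S), ((Real.sqrt (S.card : ℝ))⁻¹ : ℂ) * Q S Φ.ψ X; periodicGroundStateEnergy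 v (m + 1) L + ENNReal.ofReal (s * (2 * (m + 1) * ‖∫ X in cellN (m + 1) L, (starRingEnd ℂ) (Φ.ψ X) * Complex.exp (Complex.I * ↑(2 * Real.pi / L * ∑ j, (n j : ℝ) * X 0 j)) * Θ X‖)) ≤ periodicEnergy v Φ + ENNReal.ofReal (C * s ^ 2 * L ^ 2 / ‖(fun j => (n j : ℝ))‖ ^ 2)) → ∀ v : ℝ → ENNReal, IsRepulsiveFiniteRange v → ∃ ρ₀ : ℝ, 0 < ρ₀ ∧ ∀ ρ : ℝ, 0 < ρ → ρ < ρ₀ → ∃ c : ℝ, 0 < c ∧ ∀ᶠ N : ℕ in Filter.atTop, ∃ δ : ENNReal, 0 < δ ∧ ∀ Ψ : PeriodicTrialState N (sideLength ρ N), periodicEnergy v Ψ ≤ periodicGroundStateEnergy v N (sideLength ρ N) + δ → ENNReal.ofReal (c * N) ≤ condensateOccupation N (sideLength ρ N) Ψ.ψ) → (∀ v : ℝ → ENNReal, IsRepulsiveFiniteRange v → (∃ ρ₀ : ℝ, 0 < ρ₀ ∧ ∀ ρ : ℝ, 0 < ρ → ρ < ρ₀ → ∃ c : ℝ, 0 <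 c ∧ ∀ᶠ N : ℕ in Filter.atTop, ∃ δ : ENNReal, 0 < δ ∧ ∀ Ψ : PeriodicTrialState N (sideLength ρ N), periodicEnergy v Ψ ≤ periodicGroundStateEnergy v N (sideLength ρ N) + δ → ENNReal.ofReal (c * N) ≤ condensateOccupation N (sideLength ρ N) Ψ.ψ) → ∃ ρ₀ : ℝ, 0 < ρ₀ ∧ ∀ ρ : ℝ, 0 < ρ → ρ < ρ₀ → HasGroundStateBEC v ρ) → Literature.MathematicalPhysics.QuantumManyBody.BoseGas.BoseEinsteinCondensation

end Summit.AtomisticToContinuum.BoseEinsteinCondensation.Theses.BECThomsonDuality
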